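import Mathlib
import Literature.NumberTheory.Transcendental.SemialgebraicMapsSmoothProofs
import Literature.ModelTheory.ExponentialFields.SemialgebraicInterior
import HarnessLib

/-!
# `LogPrimitiveNL` (stmt-KontsevichZagierPeriods-2836) — line `ax-schanuel-germs`,
stub `stub_oneVarSemialgebraic` (one-variable real-semialgebraic toolkit)

(1) A function `φ` whose graph over an interval `(a, b)` is semialgebraic over `ℝ` satisfies a
non-trivial polynomial identity `q(φ t, t) = 0` on the interval: the graph, a semialgebraic set with
empty interior, is covered by the zero sets of finitely many polynomials, none vanishing identically
(`IsSemialgebraicFunOn.exists_finset_forall_exists_aeval_cons_eq_zero`); `q` is their product.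

(2) FLATNESS: if moreover `φ` is `C^∞` on `(-ε, ε)` and all its derivatives vanish at `0`, then `φ`
vanishes identically near `0`. Proof (no o-minimality): write `q(y, t) = y ^ m (y · r(t, y) + b(t))`
with `b ≠ 0` a real polynomial in `t`, `b = t ^ d · c` with `c 0 ≠ 0`. At a point `t` with
`φ t ≠ 0` we get `t ^ d c(t) = -φ(t) r(t, φ t)`; Taylor's theorem (`taylor_isLittleO`) gives
`φ t = o(t ^ (d + 1))`, `r` is bounded near `(0, 0)` and `|c t| ≥ |c 0| / 2` near `0`, so no such
`t ≠ 0` exists close to `0`, while `φ 0 = 0` by flatness.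

The bivariate bookkeeping uses Mathlib's `Polynomial.Bivariate` (`evalEval`, `Bivariate.swap`,
`Bivariate.equivMvPolynomial`).
-/

noncomputable section

open Set MeasureTheory Filter
open scoped ContDiff Topology LaurentSeries RatFunc
open Literature.NumberTheory.Transcendental Literature.ModelTheory.ExponentialFields

namespace Summit.KontsevichZagierPeriods.LiouvilleUnfolding.LogPrimitiveNL.AxSchanuelGerms

open Polynomial Asymptotics

/-! ### (1) The algebraic relation -/

/-- A function of one real variable whose graph over `(a, b)` is semialgebraic over `ℝ` satisfies a
non-trivial polynomial identity `q(φ t, t) = 0` on `(a, b)` (product of the finitely many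
polynomials, none identically zero, whose zero sets cover the graph). [folklore] -/
theorem oneVarSemialgebraic_exists_eval_eq_zero (φ : ℝ → ℝ) (a b : ℝ)
    (hφ : IsSemialgebraicFunOn ℝ {x : Fin 1 → ℝ | x 0 ∈ Ioo a b} (fun x => φ (x 0))) :
    ∃ q : MvPolynomial (Fin 2) ℝ, q ≠ 0 ∧
      ∀ t ∈ Ioo a b, MvPolynomial.eval (Fin.cons (φ t) fun _ => t) q = 0 := by
  obtain ⟨Q₀, hQ₀, hcov⟩ := hφ.exists_finset_forall_exists_aeval_cons_eq_zero
  refine ⟨∏ q ∈ Q₀, q, ?_, fun t ht => ?_⟩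
  · refine Finset.prod_ne_zero_iff.mpr fun q hq => ?_
    obtain ⟨w, hw⟩ := hQ₀ q hq
    rintro rfl
    exact hw (map_zero _)
  · obtain ⟨q, hq, hq0⟩ := hcov (fun _ => t) ht
    rw [map_prod]
    exact Finset.prod_eq_zero hq (by simpa using hq0)

/-! ### (2) Flatness: bivariate bookkeeping -/

/-- Evaluation of the bivariate polynomial attached to `q ∈ ℝ[X₀, X₁]`, the outer variable playing
the role of `X₀` and the inner (coefficient) variable that of `X₁`: it is `q(y, t)`. [folklore] -/
theorem evalEval_swap_equivMvPolynomial_symm (q : MvPolynomial (Fin 2) ℝ) (t y : ℝ) :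
    (Bivariate.swap ((Bivariate.equivMvPolynomial ℝ).symm q)).evalEval t y =
      MvPolynomial.eval (Fin.cons y fun _ => t : Fin 2 → ℝ) q := by
  have h : (aevalAeval t y).comp
      (((Bivariate.swap (R := ℝ)) : ℝ[X][X] →ₐ[ℝ] ℝ[X][X]).comp
        ((Bivariate.equivMvPolynomial ℝ).symm : MvPolynomial (Fin 2) ℝ →ₐ[ℝ] ℝ[X][X])) =
      MvPolynomial.aeval (Fin.cons y fun _ => t : Fin 2 → ℝ) := by
    refine MvPolynomial.algHom_ext fun i => ?_
    fin_cases i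
    · simp [Bivariate.swap_X]
    · simp [Bivariate.swap_Y]
  have := AlgHom.congr_fun h q
  simpa [coe_aevalAeval_eq_evalEval] using this

/-- Joint continuity of `(t, y) ↦ p(t, y)` for a bivariate real polynomial `p`. [folklore] -/
theorem continuous_evalEval (p : ℝ[X][X]) : Continuous fun z : ℝ × ℝ => p.evalEval z.1 z.2 := by
  induction p using Polynomial.induction_on' with
  | add p q hp hq => simpa [evalEval_add] using hp.fun_add hq
  | monomial n a =>
    simp only [evalEval, eval_monomial, eval_mul, eval_pow, eval_C]
    fun_prop

/-! ### (2) Flatness: the analytic core -/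

/-- **Flat solutions of a non-trivial polynomial identity vanish.** If `P(t, y) ∈ ℝ[t][y]` is
non-zero, `P(t, φ t) = 0` near `t = 0` and `φ t = o(t ^ n)` at `0` for every `n`, then `φ = 0` near
`0`: with `P = y ^ m · Q`, `Q(t, 0) = b(t) ≠ 0`, `Q = y · R + b`, `b = t ^ d · c`, `c 0 ≠ 0`, a
point `t ≠ 0` with `φ t ≠ 0` gives `|t| ^ d |c t| = |φ t| |R(t, φ t)| ≤ M |t| ^ (d + 1)`,
impossible for small `t`. [folklore] -/
theorem eventually_eq_zero_of_evalEval_eq_zero {P : ℝ[X][X]} (hP : P ≠ 0) {φ : ℝ → ℝ}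
    (hPφ : ∀ᶠ t in 𝓝 (0 : ℝ), P.evalEval t (φ t) = 0)
    (hflat : ∀ n : ℕ, φ =o[𝓝 (0 : ℝ)] fun t => t ^ n) :
    ∀ᶠ t in 𝓝 (0 : ℝ), φ t = 0 := by
  -- `φ 0 = 0` and `φ` is continuous at `0`
  have hφ0 : φ 0 = 0 := by
    have h := (hflat 1).eventuallyLE.self_of_nhds
    simpa using h
  have hcont : ContinuousAt φ 0 := by
    have h0 : φ =o[𝓝 (0 : ℝ)] (fun _ => (1 : ℝ)) := (hflat 0).congr_right fun t => pow_zero t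
    have h1 := (isLittleO_one_iff ℝ).1 h0
    rwa [ContinuousAt, hφ0]
  -- `P = y ^ m Q`, `Q(t, 0) = b t ≠ 0`
  obtain ⟨Q, hPQ, hQdvd⟩ := P.exists_eq_pow_rootMultiplicity_mul_and_not_dvd hP 0
  rw [dvd_iff_isRoot, IsRoot.def, ← coeff_zero_eq_eval_zero] at hQdvd
  -- `b = t ^ d c`, `c 0 ≠ 0`
  obtain ⟨c, hbc, hcdvd⟩ := (Q.coeff 0).exists_eq_pow_rootMultiplicity_mul_and_not_dvd hQdvd 0
  rw [dvd_iff_isRoot, IsRoot.def] at hcdvd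
  set m : ℕ := P.rootMultiplicity 0 with hm
  set d : ℕ := (Q.coeff 0).rootMultiplicity 0 with hd
  -- the identity `P(t, y) = y ^ m (R(t, y) y + t ^ d c(t))`, `R = Q.divX`
  have hid : ∀ t y : ℝ,
      P.evalEval t y = y ^ m * (Q.divX.evalEval t y * y + t ^ d * c.eval t) := by
    intro t y
    have hQ := congrArg (evalEval t y) (divX_mul_X_add Q)
    simp only [evalEval_add, evalEval_mul, evalEval_X, evalEval_C] at hQ
    have hb : (Q.coeff 0).eval t = t ^ d * c.eval t := by
      rw [hbc]
      simp [hd]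
    rw [hPQ, evalEval_mul, evalEval_pow, evalEval_sub, evalEval_X, evalEval_C, ← hQ, hb]
    simp [hm]
  -- `R(t, φ t)` is bounded near `0`
  have hgc : ContinuousAt (fun t => Q.divX.evalEval t (φ t)) 0 :=
    (continuous_evalEval Q.divX).continuousAt.comp (continuousAt_id.prodMk hcont)
  set M : ℝ := ‖Q.divX.evalEval 0 (φ 0)‖ + 1 with hM
  have hMev : ∀ᶠ t in 𝓝 (0 : ℝ), ‖Q.divX.evalEval t (φ t)‖ < M :=
    hgc.norm.tendsto.eventually (eventually_lt_nhds (lt_add_one _))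
  have hM0 : 0 ≤ M := by positivity
  -- `|c t| ≥ |c 0| / 2` near `0`
  have hc0 : 0 < ‖c.eval 0‖ := norm_pos_iff.mpr hcdvd
  have hcev : ∀ᶠ t in 𝓝 (0 : ℝ), ‖c.eval 0‖ / 2 < ‖c.eval t‖ :=
    (c.continuousAt (a := 0)).norm.tendsto.eventually (eventually_gt_nhds (half_lt_self hc0))
  -- `M |t| < |c 0| / 2` near `0`
  have hsmall : ∀ᶠ t in 𝓝 (0 : ℝ), M * ‖t‖ < ‖c.eval 0‖ / 2 := by
    have h : Tendsto (fun t : ℝ => M * ‖t‖) (𝓝 0) (𝓝 (M * ‖(0 : ℝ)‖)) :=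
      (continuous_const.mul continuous_norm).tendsto 0
    rw [norm_zero, mul_zero] at h
    exact h.eventually (eventually_lt_nhds (half_pos hc0))
  -- flatness with exponent `d + 1`
  have hfl : ∀ᶠ t in 𝓝 (0 : ℝ), ‖φ t‖ ≤ ‖t ^ (d + 1)‖ := (hflat (d + 1)).eventuallyLE
  filter_upwards [hPφ, hMev, hcev, hsmall, hfl] with t hPt hMt hct hst hflt
  by_contra hne
  have ht0 : t ≠ 0 := by
    rintro rfl
    exact hne hφ0
  rw [hid] at hPt
  have h1 : Q.divX.evalEval t (φ t) * φ t + t ^ d * c.eval t = 0 :=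
    (mul_eq_zero.mp hPt).resolve_left (pow_ne_zero _ hne)
  have h2 : ‖t‖ ^ d * ‖c.eval t‖ ≤ ‖t‖ ^ d * (M * ‖t‖) := by
    have h := eq_neg_of_add_eq_zero_right h1
    calc ‖t‖ ^ d * ‖c.eval t‖ = ‖t ^ d * c.eval t‖ := by rw [norm_mul, norm_pow]
      _ = ‖Q.divX.evalEval t (φ t)‖ * ‖φ t‖ := by rw [h, norm_neg, norm_mul]
      _ ≤ M * ‖t ^ (d + 1)‖ := mul_le_mul hMt.le hflt (norm_nonneg _) hM0
      _ = ‖t‖ ^ d * (M * ‖t‖) := by rw [norm_pow]; ring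
  have h3 : ‖c.eval t‖ ≤ M * ‖t‖ :=
    le_of_mul_le_mul_left h2 (pow_pos (norm_pos_iff.mpr ht0) d)
  linarith

/-- Flatness at `0` of a function `C^∞` on `(-ε, ε)` gives `φ t = o(t ^ n)` at `0` for every `n`
(Taylor's theorem `taylor_isLittleO` with vanishing Taylor polynomial). [folklore] -/
theorem isLittleO_pow_of_flat {φ : ℝ → ℝ} {ε : ℝ} (hε : 0 < ε)
    (hφ : ContDiffOn ℝ ∞ φ (Ioo (-ε) ε)) (hflat : ∀ n : ℕ, iteratedDeriv n φ 0 = 0) (n : ℕ) :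
    φ =o[𝓝 (0 : ℝ)] fun t => t ^ n := by
  have h0 : (0 : ℝ) ∈ Ioo (-ε) ε := ⟨neg_lt_zero.mpr hε, hε⟩
  have hopen : IsOpen (Ioo (-ε) ε) := isOpen_Ioo
  have h := taylor_isLittleO (convex_Ioo (-ε) ε) h0 (contDiffOn_infty.1 hφ n) (x₀ := 0)
  rw [hopen.nhdsWithin_eq h0] at h
  have htaylor : ∀ x, taylorWithinEval φ n (Ioo (-ε) ε) 0 x = 0 := by
    intro x
    rw [taylor_within_apply]
    refine Finset.sum_eq_zero fun k _ => ?_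
    rw [iteratedDerivWithin_of_isOpen hopen h0, hflat k, smul_zero]
  simpa [htaylor] using h

/-- Part (2) of the toolkit: a function semialgebraic over `ℝ` on `(-ε, ε)`, `C^∞` there and flat
at `0`, vanishes near `0`. [folklore] -/
theorem oneVarSemialgebraic_flat (φ : ℝ → ℝ) (ε : ℝ) (hε : 0 < ε)
    (hφ : IsSemialgebraicFunOn ℝ {x : Fin 1 → ℝ | x 0 ∈ Ioo (-ε) ε} (fun x => φ (x 0)))
    (hsmooth : ContDiffOn ℝ ∞ φ (Ioo (-ε) ε)) (hflat : ∀ n : ℕ, iteratedDeriv n φ 0 = 0) :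
    ∀ᶠ t in 𝓝 (0 : ℝ), φ t = 0 := by
  obtain ⟨q, hq, hqφ⟩ := oneVarSemialgebraic_exists_eval_eq_zero φ (-ε) ε hφ
  have hP0 : Bivariate.swap ((Bivariate.equivMvPolynomial ℝ).symm q) ≠ 0 := by
    simpa using hq
  refine eventually_eq_zero_of_evalEval_eq_zero hP0 ?_ (isLittleO_pow_of_flat hε hsmooth hflat)
  filter_upwards [Ioo_mem_nhds (neg_lt_zero.mpr hε) hε] with t ht
  rw [evalEval_swap_equivMvPolynomial_symm]
  exact hqφ t ht

/-! ### The registered stub -/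

/-- **One-variable real-semialgebraic toolkit.** (1) A function whose graph over an open interval is
semialgebraic over `ℝ` satisfies a non-trivial polynomial identity `q(φ t, t) = 0` on the interval
(its graph has empty interior, sign-condition normal form; product of the finitely many
polynomials). (2) FLATNESS: such a function which is moreover `C^∞` on the interval and has all
derivatives `0` at `0` vanishes identically near `0` (Taylor remainder against the lowest
non-vanishing `Y`-coefficient of `q`, which is a non-zero real polynomial in `t`). [folklore] -/
theorem stub_oneVarSemialgebraic :
    (∀ (φ : ℝ → ℝ) (a b : ℝ), a < b →
      IsSemialgebraicFunOn ℝ {x : Fin 1 → ℝ | x 0 ∈ Ioo a b} (fun x => φ (x 0)) →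
        ∃ q : MvPolynomial (Fin 2) ℝ, q ≠ 0 ∧
          ∀ t ∈ Ioo a b, MvPolynomial.eval (Fin.cons (φ t) fun _ => t) q = 0) ∧
    (∀ (φ : ℝ → ℝ) (ε : ℝ), 0 < ε →
      IsSemialgebraicFunOn ℝ {x : Fin 1 → ℝ | x 0 ∈ Ioo (-ε) ε} (fun x => φ (x 0)) →
        ContDiffOn ℝ ∞ φ (Ioo (-ε) ε) → (∀ n : ℕ, iteratedDeriv n φ 0 = 0) →
          ∀ᶠ t in 𝓝 (0 : ℝ), φ t = 0) :=
  ⟨fun φ a b _ hφ => oneVarSemialgebraic_exists_eval_eq_zero φ a b hφ,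
    fun φ ε hε hφ hs hf => oneVarSemialgebraic_flat φ ε hε hφ hs hf⟩

end Summit.KontsevichZagierPeriods.LiouvilleUnfolding.LogPrimitiveNL.AxSchanuelGerms

end
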